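import Mathlib
import HarnessLib
import HarnessLib.Audit
import Summits.CriticalPhenomena.Statement
import Summits.CriticalPhenomena.Ising3DConformalLimit.Theorems.HyperoctahedralRPTwoPointKernelOfLimit
import Summits.CriticalPhenomena.Ising3DConformalLimit.Theorems.HyperoctahedralRPExistsScaleCovariantLimitSplitGlue
import HarnessLib.Audit.Status.Attr

/-!
Route: GaussianScaleMixture

DORMANT since 2026-08-25T15:55:33Z (reconciler: no traction for 7.8 d (last activity item-evidence-added at 2026-08-17T19:18:53Z); parked, not closed — `ledger route dormant route-CriticalPhenomena-GaussianScaleMixture --off` to reactiv) — unstaffed, not closed; items shared with open routes are served there. `ledger route dormant <id> --off` reactivates.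

# Route GaussianScaleMixture — critical ⟨σ₀σₓ⟩ on ℤ³ is a Gaussian scale mixture — joint complete
monotonicity in x², simplex RP rigidity, O(3) from one amplitude

It suffices to show X_GSM = (G) ∧ (R) ∧ (N) ∧ (C) ∧ (D) ∧ (E), realising card
gaussian-scale-mixture-anisotropy (spine, sole card).
(G) CriticalTwoPointGSM [crux r2, the card's K1, the new object]: the critical two-point function of
the n.n. Ising model on ℤ³ is a
GAUSSIAN SCALE MIXTURE, ⟨σ₀σ_x⟩⁺_{β_c} = ∫ exp(−s₁x₁²−s₂x₂²−s₃x₃²) ν(ds) with ν an exchangeable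
probability measure on [0,∞)³ — the
anisotropy mixing measure; equivalently G is completely monotone in the squared coordinates. (R)
GSMRigidity [crux r3, the card's K2 =
DQR]: a continuous positive homogeneous (degree −2Δ, 1/2 ≤ Δ ≤ 1) kernel on ℝ³∖0 that is reflection
positive in the nine lattice mirrors
AND a Gaussian scale mixture is O(3)-invariant (HRP2Rigidity of route HyperoctahedralRP restricted
to the GSM cone, where it collapses to
a positivity statement for a measure on the 2-simplex). (N) RotationUpgradeFromTwoPoint [crux r4]:
two-point isotropy of a normalised
scale-covariant limit upgrades to IsRotationInvariant S. (C) ExistsScaleCovariantLimit, (D)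
InversionUpgradeNormalised, (E)
IsingEuclidUpgradeR4NonGaussian [cruxes r5–r7, shared verbatim with HyperoctahedralRP items
stmt-1981/1982/0636]. Glue (support):
LimitKernelGSM (G passes to every scaling limit, Bernstein–Widder) and TwoPointKernelOfLimit (=
stmt-1983). Dividends filed as support,
provable now: OneAmplitudeIsotropy (for exchangeable GSM kernels A_axis ≥ A_face-diagonal with
equality iff radial — "O(3) from one
amplitude") and GSMSchurOrder (x² ≻ y² on a Euclidean lattice sphere ⇒ ⟨σ₀σ_y⟩ ≤ ⟨σ₀σ_x⟩: new exact
finite-distance inequalities).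
Lean: `CriticalTwoPointGSM ∧ GSMRigidity ∧ RotationUpgradeFromTwoPoint ∧ ExistsScaleCovariantLimit ∧
InversionUpgradeNormalised ∧ IsingEuclidUpgradeR4NonGaussian`

## Assembly
Pure logic (term proof `assembly_check` in the planner's Sketch.lean, rc 0): take ρ, Δ, S from (C)
(normalised, non-degenerate,
translation invariant, scale covariant, Δ > 0); LimitKernelGSM applied to (G) gives the GSM
representation of K = S 2 (0,·);
TwoPointKernelOfLimit gives the Δ-window, continuity, positivity, homogeneity and nine-mirror
invariance/RP of K; (R) then gives
K ∘ R = K for all linear isometries; (N) upgrades to IsRotationInvariant S, so IsEuclideanInvariant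
S := ⟨transl, rot⟩; (D) gives
IsInversionCovariant Δ S and IsMoebiusCovariant Δ S := ⟨Euclid, scale, inversion⟩
(ConformalCovariance.lean); (E) gives HasNontrivialU4 S;
conclude CritIsing3DConformalLimit = Ising3DConformalLimit.

Rationale: WHY THIS LINE. Rotation invariance of the critical ℤ³ limit is only postulated (DuminilCopinICM2022
§8.1) and what is KNOWN about the angular structure of
⟨σ₀σ_x⟩ is one variable at a time: the ℓ∞/ℓ¹ sandwich G(‖x‖∞e₁) ≥ G(x) ≥ G(‖x‖₁e₁) of
MessagerMiracleSoleJSP1977/Hegerfeldt1977 and the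
per-direction Stieltjes (transfer-matrix) structure of arXiv:1912.07973 Prop 4.6. The card posits
the JOINT positivity — one mixing measure
for all directions, the Bochner→Schoenberg upgrade applied to anisotropy instead of divisibility —
whose Gaussian case is a theorem (lattice
heat kernels and Green functions are GSM by the Hartman–Watson law, doi:10.1214/aop/1176996606) and
whose level was fixed by a real test
(the stronger lattice-symbol version LHM has an anisotropy floor K₄/M₂ ≥ 2/5 and dies on γ₄ = ω_NR −
2 > 0, arXiv:2105.09781,
arXiv:cond-mat/9705086: "interacting ⇒ rounder than free"). Imported areas: harmonic analysis on
semigroups / multivariate complete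
monotonicity (BergChristensenRessel1984, SchillingSongVondracek2012), majorisation
(Hardy–Littlewood–Pólya), Brownian subordination
(Hartman–Watson), reflection positivity in diagonal site planes (FrohlichEtAl1978). What it does
that HyperoctahedralRP does not: it
replaces the open classification of ALL nine-mirror-RP homogeneous kernels (open exactly at
quadratic-form mixtures) by rigidity inside the
GSM cone, where coordinate mirrors are free, anti-diagonal ⇔ swap, and anisotropic components carry
complex-rotated mirror-time spectral
mass Re e^{−(ρ−iκ)|q|t} growing like e^{κ|q|τ} at imaginary time — a Phragmén–Lindelöf handle; and
it yields lattice inequalities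
testable at |x| ≤ 7 plus a one-number isotropy criterion. Negatives index (stmt-0772, SAW)
untouched.

RANKED CRUXES. #2 CriticalTwoPointGSM (crux) — (card K1) GSM at β_c(3): there is an exchangeable
probability measure ν on the closed octant [0,∞)³ with ⟨σ₀σ_x⟩⁺_{β_c,0} = ∫ exp(−Σᵢ sᵢxᵢ²) ν(ds) for
every x ∈ ℤ³ (ν(mass)=1 because G(0)=1) — the critical two-point function is completely monotone in
the squared coordinates, a positive superposition of axis-aligned Gaussian kernels ("Brownian motion
with three exchangeable random clocks"). Consistent with everything proved (MMS sandwich,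
per-direction Stieltjes structure, IR monotonicity of Ĝ in each |p_j|), exact in every solvable
member (free fields of all masses, d = 1, N = ∞, high-T leading order) and with the sign of the 3D
anisotropy amplitude. [difficulty: open-problem] (why it might fail: no inequality controls JOINT
mixed differences in two lattice directions (RP gives each direction separately, MMS only
monotonicity); exact GSM may fail at |x| ≤ 3 (NNLS-infeasible short-distance values) while only an
eventual/asymptotic GSM survives.) [arXiv:1912.07973, doi:10.1214/aop/1176996606,
MessagerMiracleSoleJSP1977, Hegerfeldt1977, arXiv:2105.09781]
#3 GSMRigidity (crux) — (card K2 = DQR, kernel form) every continuous positive kernel K on ℝ³∖0,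
homogeneous of degree −2Δ with 1/2 ≤ Δ ≤ 1, invariant and reflection positive w.r.t. the nine
lattice mirror normals eᵢ, eᵢ ± eⱼ (the hypotheses of HRP2Rigidity, stmt-1979, verbatim) which is
moreover a Gaussian scale mixture off the origin (K(x) = ∫ e^{−Σ sᵢxᵢ²} ν(ds), ν a Radon measure on
the closed octant, integrand integrable at every x ≠ 0) is invariant under every linear isometry.
Equivalent simplex form: an exchangeable Φ on the 2-simplex with Γ(Δ)∫(ω·x²)^{−Δ}Φ(dω)
swap-reflection-positive is δ_centre (coordinate mirrors are RP termwise since (ω·x²)^{−Δ} is the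
Riesz kernel after a diagonal linear change and Δ ≥ 1/2; anti-diagonal ⇔ swap for
coordinatewise-even kernels). Strictly weaker than HRP2Rigidity; its negation refutes stmt-1979 too.
[difficulty: L] (why it might fail: a continuous Φ concentrated near the centre might keep all swap
positivities: each anisotropic component spoils mirror-time complete monotonicity only through terms
e^(κ|q|τ) growing at imaginary time, and a tuned continuum of components could interfere
destructively.) [FrohlichEtAl1978, BergChristensenRessel1984, SchillingSongVondracek2012,
GlimmJaffe1987, arXiv:2404.05700]
#4 RotationUpgradeFromTwoPoint (crux) — every normalised (S = 0 off NonCoincident), non-degenerate,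
translation-invariant, scale-covariant pointwise scaling limit S of criticalCorr 3 (ρ > 0 on (0,1])
whose two-point kernel x ↦ S 2 (0,x) is invariant under all linear isometries (x ≠ 0) is
IsRotationInvariant (all n, O(3) incl. reflections). The n-point half of the isotropy problem,
stated so that HyperoctahedralRP can consume it too (HRP2Rigidity ∘ TwoPointKernelOfLimit gives the
hypothesis); intended engines: OS continuation of S_n in the nine lattice time directions + B₃ +
round S₂, or boost/modular covariance. [difficulty: open-problem] (why it might fail: round S₂ with
merely B₃-invariant S₄ is excluded by no known argument: nine-direction OS positivity + one Δ may
not pin rotations of n ≥ 3-point functions without a spectral-condition input; no n-point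
multi-mirror continuation theorem exists.) [DuminilCopinICM2022, GlimmJaffe1987, arXiv:2012.11672,
FrohlichEtAl1978]
#5 ExistsScaleCovariantLimit (crux) — (shared verbatim with HyperoctahedralRP stmt-1981) there are ρ
> 0 on (0,1], Δ > 0 and S with HasPointwiseScalingLimit (criticalCorr 3) ρ S, S = 0 off
NonCoincident, IsNondegenerateTwoPoint S, IsTranslationInvariant S, IsScaleCovariant Δ S — NO
rotation clause (isotropy is output of this route). [difficulty: open-problem] (why it might fail:
full δ→0⁺ convergence with ONE continuous Δ is open on ℤ³: only subsequential limits follow from the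
two-point bounds, and RP/GKS two-point axiomatics admit log-periodic (discretely scale covariant)
profiles.) [DuminilCopinICM2022, DuminilcopinPanis2025, arXiv:1912.07973,
AizenmanDuminilCopinAnnals2021]
#6 InversionUpgradeNormalised (crux) — (shared verbatim with HyperoctahedralRP stmt-1982) every
normalised, non-degenerate, Euclidean-invariant, scale-covariant pointwise scaling limit of
criticalCorr 3 is inversion covariant with the same Δ (Polyakov's upgrade, typed with the
NonCoincident normalisation demanded by Theorems/IsingEuclidUpgradeRefutations.lean). [deps:
RotationUpgradeFromTwoPoint] [difficulty: open-problem] (why it might fail: scale + RP + Euclid ⇏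
Möbius in general (free Maxwell d=3; RP descendant witnesses); for Ising it fails if the limit
carries a virial current of dimension exactly 2 or lacks a local stress tensor — excluded only
numerically (Δ_V > 5).) [ElshowkNakayamaRychkov2011, Nakayama2015, DelamotteTissierWschebor2016,
PolandRychkovVichi2019, DuminilCopinICM2022]
#7 IsingEuclidUpgradeR4NonGaussian (crux) — (shared verbatim, stmt-0636) every non-degenerate
pointwise scaling limit S of the renormalised critical Ising correlators on ℤ³ has connected
four-point function U₄ ≢ 0 on non-coincident configurations. [difficulty: open-problem] (why it
might fail: no proof that U₄ ≢ 0 in d = 3: the double-current intersection probability at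
macroscopic separation must stay > 0 as δ → 0; RP long-range models on ℤ³ (α < 3/2) are Gaussian
(LongRangeTrivialityOnZ3).) [AizenmanDuminilCopinAnnals2021, DuminilCopinICM2022]
#9 LimitKernelGSM (support) — glue: CriticalTwoPointGSM ⇒ for every non-degenerate,
translation-invariant, scale-covariant pointwise scaling limit S of criticalCorr 3 the kernel K(x) =
S 2 (0,x) is a Gaussian scale mixture off the origin (Radon ν on the closed octant, integrand
integrable and K(x) = ∫e^(−Σ sᵢxᵢ²)ν(ds) at every x ≠ 0). Route: ν_δ := ρ(δ)²·(s ↦ s/δ²)_*ν; F_δ(u)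
= ∫e^(−t·u)ν_δ(dt) is CM and ρ(δ)²G(⌊x/δ⌋) = F_δ((δ⌊xᵢ/δ⌋)²ᵢ); squeeze between K((1±ε)x) by
coordinatewise monotonicity + homogeneity ⇒ F_δ → F on the open octant; limits of CM functions are
CM ⇒ Bernstein–Widder on the cone gives ν_∞; boundary faces by monotone convergence + continuity of
K at the axes/planes (ℓ¹/ℓ∞ and diagonal MMS sandwich). Measure-free fallback interface
(finite-difference CM) if provers prefer. [difficulty: M] [BergChristensenRessel1984,
SchillingSongVondracek2012, arXiv:1912.07973]
#9 TwoPointKernelOfLimit (support) — (shared verbatim with HyperoctahedralRP stmt-1983) for every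
non-degenerate, translation-invariant, scale-covariant pointwise scaling limit S of criticalCorr 3
the kernel K x := S 2 (0,x) meets the hypotheses of HRP2Rigidity/GSMRigidity: 1/2 ≤ Δ ≤ 1
(scalingDimension_mem_Icc_holds), ContinuousOn K off 0 (MMS axis + diagonal monotonicity +
homogeneity), K > 0 off 0, homogeneity, nine-mirror invariance and nine-mirror reflection positivity
(FILS site-plane RP via isingMeasure_univ_free_reflectionPositive +
hasBoxLimit_isingCorr_plus_holds, closed under limits). [difficulty: M] [MessagerMiracleSoleJSP1977,
FrohlichEtAl1978, DuminilcopinPanis2025]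
#9 OneAmplitudeIsotropy (support) — dividend "O(3) from one amplitude" (pure analysis, provable
now): if K(x) = ∫e^(−Σ sᵢxᵢ²)ν(ds) off the origin with ν exchangeable on the closed octant, then
K(e₁) = K((e₁+e₂)/√2) forces K(Rx) = K(x) for every linear isometry R and x ≠ 0. Proof: K(e₁) =
∫(e^(−s₁)+e^(−s₂))/2 dν ≥ ∫e^(−(s₁+s₂)/2)dν = K((e₁+e₂)/√2) by convexity, with equality iff s₁ = s₂
ν-a.e.; exchangeability then gives s₁ = s₂ = s₃ a.e. and K is a function of ‖x‖. No homogeneity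
needed; for the scale-covariant limit kernel the two numbers are the axis and face-diagonal
amplitudes A(e₁) ≥ A((e₁+e₂)/√2) — isotropy of S₂ ⇔ one amplitude identity between the two
reflection-positive transfer directions. [difficulty: provable-now] [doi:10.1214/aop/1176996606,
BergChristensenRessel1984, arXiv:1912.07973]
#9 GSMSchurOrder (support) — dividend (provable now): Schur order of the critical two-point function
on Euclidean lattice spheres: CriticalTwoPointGSM ⇒ for x, y ∈ ℤ³ with Σxᵢ² = Σyᵢ², max yᵢ² ≤ max
xᵢ² and min xᵢ² ≤ min yᵢ² (for three coordinates this IS x² ≻ y²), ⟨σ₀σ_y⟩ ≤ ⟨σ₀σ_x⟩; smallest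
instances G(2,2,1) ≤ G(3,0,0), G(3,2,2) ≤ G(4,1,0), G(4,3,0) ≤ G(5,0,0), G(4,3,1) ≤ G(5,1,0),
G(3,3,3) ≤ G(5,1,1), G(4,3,2) ≤ G(5,2,0), G(4,3,3) ≤ G(5,3,0), G(5,4,3) ≤ G(5,5,0) ≤ G(7,1,0) (NB
the card's pair G(3,3,0) ≤ G(4,1,1) is NOT implied: (16,1,1), (9,9,0) are incomparable). Proof: F(u)
= ∫e^(−s·u)dν is convex along each transfer u ↦ (u₁+ε, u₂−ε, u₃) and symmetric about ε = (u₂−u₁)/2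
(exchangeability), and a 3-vector majorisation is two transfers (Hardy–Littlewood–Pólya); the
Euclidean sphere inserted into the 1977 ℓ∞/ℓ¹ sandwich. [difficulty: provable-now]
[MessagerMiracleSoleJSP1977, Hegerfeldt1977, arXiv:2105.09781]

TWO-LAYER PLAN. Foreseen glued splits (none filed now; k ≤ 3, depth 1): GSMRigidity ⇐
SwapPairRigidity (one swap mirror x₁ = x₂ forces ω₁ = ω₂ Φ-a.e., the
Phragmén–Lindelöf step on the mirror-time Laplace transform at transverse momentum q₃ = 0) →
ExchangeToCentre (two swap mirrors +
exchangeability ⇒ Φ = δ_centre ⇒ radial) → GSMRigidity. CriticalTwoPointGSM ⇐ PlanarSliceGSM (joint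
CM of (x₁², x₂²) ↦ G(x₁,x₂,0), the
first genuinely two-directional inequality) → LiftToThree → CriticalTwoPointGSM, or, after a
short-distance refutation, the restate
EventualGSM (G = GSM-part·(1+o(1)) at infinity, still sufficient for LimitKernelGSM).
RotationUpgradeFromTwoPoint ⇐ NineDirectionOS
(OS positivity of all S_n in the nine lattice time directions passes to the limit) → ContinuationB3
(analytic continuation + B₃ + round S₂
⇒ O(3)) → RotationUpgradeFromTwoPoint.

KILL CRITERIA. ¬GSMRigidity — one anisotropic, continuous, positive, homogeneous (1/2 ≤ Δ ≤ 1),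
nine-mirror-RP Gaussian-scale-mixture kernel — closes the
route (close --reason refuted:GSMRigidity), refutes HRP2Rigidity (stmt-1979) of HyperoctahedralRP as
well, and becomes the barrier entry
"lattice RP + scaling + GSM ⇏ isotropy"; the surviving dividend OneAmplitudeIsotropy (isotropy ⇔
A(e₁) = A((e₁+e₂)/√2)) would then be
re-filed as a new, different route fed by transfer-matrix spectral data, not as a repair.
¬CriticalTwoPointGSM by an ASYMPTOTIC witness
(diagonal directions favoured at large distance at β_c, i.e. negative ℓ = 4 amplitude, or Φ_limit ≠
δ forced) closes the route
refuted:CriticalTwoPointGSM; ¬CriticalTwoPointGSM by a SHORT-DISTANCE obstruction only (values at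
|x| ≤ 3) forces the restate to
EventualGSM (repair (a)), not a close. ¬RotationUpgradeFromTwoPoint pivots the n-point step to the
boost/modular engine (shared fate with
HyperoctahedralRP's LimitRotationInvariant). (C), (D), (E) are shared with
HyperoctahedralRP/IsingEuclidUpgrade: their refutation kills the
conjunct or all routes alike. HRP2Rigidity proved elsewhere moots GSMRigidity (one-line corollary)
but not the route's stand-alone
dividends.

NOT DECOMPOSED YET. The natural general form of GSM (all β ≥ 0, h = 0, n.n. ℤ^d; d = 2 exactly
testable through Toeplitz/Perk values at β_c(2)) — only
β_c(3) is load-bearing, so it is not filed; the LHM negative result (lattice-heat-kernel mixtures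
have K₄/M₂ ≥ 2/5, killed near β_c by
γ₄ = ω_NR − 2 > 0) — conditional on numerical exponents, kept on the card as negative knowledge; the
free anchor (lattice heat kernel /
massive Green function / SRW Green function are GSM by Hartman–Watson) — a Literature fact to
request when a prover wants it, not an item;
a measure-free (finite-difference CM) restatement of the GSM interface between LimitKernelGSM and
GSMRigidity should Bernstein–Widder in
three variables prove too heavy to formalise; the local (linearised at δ_centre) versus global split
of GSMRigidity; constants of the
Schur gaps; tightness/uniqueness inputs behind (C).

CHEAPEST FALSIFIER. For r3 (and HRP's stmt-1979 at once): take ONE symmetrised anisotropic component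
k(x) = Σ_(σ∈S₃) (ω_σ·x²)^(−Δ), ω = (1+ε, 1−ε, 1)/3,
Δ = 0.518, ε ∈ {0.05, 0.2, 0.5}, and test swap-RP numerically: eigenvalues of the Gram matrices
[k(p_a − θ₁₂ p_b)] on ~300 random points of
{x₁ > x₂} spread over scales 1…10³ (the violation is expected in configurations elongated parallel
to the mirror / at imaginary
mirror-time, so include long thin clouds) — a certified PSD family for some ε ≠ 0 kills r3
instantly; a clear negative eigenvalue for every
ε supports the Phragmén–Lindelöf picture. For r2: the card's Swendsen–Wang run (L = 32 at β_c =
0.2216546, FFT estimator, jackknife,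
≈ 30 min/core) printing the Schur gaps G(3,0,0)−G(2,2,1), G(4,1,0)−G(3,2,2), G(5,0,0)−G(4,3,0),
G(5,1,0)−G(4,3,1), G(5,1,1)−G(3,3,3),
G(5,2,0)−G(4,3,2) (predicted > 0, ≈ 2·10⁻³ at r = 3 against errors ≈ 2·10⁻⁴) and the NNLS
feasibility of {G(x)}_(|x|≤6) against
symmetrised Gaussian kernels; one significantly NEGATIVE Schur gap kills exact GSM at β_c (then:
EventualGSM or close). Neither was run in
this plancard seat (no kit job submitted); both are specified for the refuter.

NUMBERS. β_c(3) = 0.221654626(5); Δ_σ = 0.5181489(10) (inside the rigorous window 1/2 ≤ Δ ≤ 1,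
scalingDimension_mem_Icc_holds); ω_NR = Δ_(C,ℓ=4) − 3 =
2.022665(28) and (r₃ − 1)ξ^(ω_NR) ≈ +0.029, axes favoured, for the n.n. model; isotropy-improved
third-neighbour coupling q₃^iso = 0.129
(arXiv:2105.09781 §3–4); LHM floor K₄[G]/M₂[G] ≥ 2/5 versus K₄/M₂ ~ ξ^(−γ₄) → 0, γ₄ = 0.0227 (card;
arXiv:cond-mat/9705086 §4.2); 2D sanity
G(1,1) = 2/π = 0.6366 ≤ G(1,0)^(2/3)G(2,0)^(1/3) = 0.6674; expected Schur gap at r = 3 ≈ 0.06·B·G ≈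
2·10⁻³. Items at open: 11 (6 cruxes, of
which 3 shared; 4 support, of which 1 shared; 1 assembly).

DEFINITION REQUESTS. None filed at open: the notions the card lists (IsGaussianScaleMixture,
SqMajorizes/IsSchurMonotoneOnSpheres, IsGSMKernel, IsSwapRP) are
inlined in the items (a Measure on Fin 3 → ℝ with ν{∃ i, sᵢ < 0} = 0; max/min/sum form of 3-vector
majorisation; the nine-mirror block of
stmt-1979), so no definition debt blocks staffing. Cite-fact to request when a prover of the
dividends wants the free anchor: "the
lattice heat kernel e^(tΔ_ℤᵈ), the massive lattice Green function and the SRW Green function are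
Gaussian scale mixtures" via the
Hartman–Watson law I_ν(r)/I₀(r) = E[e^(−ν²H_r/2)] (doi:10.1214/aop/1176996606; Mansuy–Yor 2008 Thm
5.1).

Novelty: Searches (2026-08-15, this planner, on top of the card author's six hybrid / seven crossref / three
zbmath / one vsearch / two galaxy
sweeps recorded on the card): `lit search --hybrid "Gaussian scale mixture completely monotone
squared coordinates two-point function
lattice anisotropy"` (10 docs, none relevant: lace-expansion and RG textbooks, statistics mixtures);
`lit vsearch` on the GSM statement in
prose (10 docs: Friedli–Velenik, Glimm–Jaffe, Cardy — generic two-point pages, no mixing measure);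
`lit galaxy search "Gaussian scale
mixture" --star all` (21 rows, ALL image-processing / Bayesian statistics, none in statistical
mechanics — the card author's timed-out
query, now run); `lit galaxy search --star all` on the long GSM phrase and on "Schur-convex function
of the squared" (0 and 0);
`lit search --source crossref "Ising two-point function anisotropy restoration rotational invariance
cubic lattice correlation"` (10:
nearest doi:10.1016/0375-9601(76)90179-1 Barouch–McCoy–Tracy–Wu 1976 and
doi:10.1016/0375-9601(76)90219-x Bariev 1976 — rotational
invariance of the leading 2D critical asymptotics and its lattice corrections, exact planar, no
positivity structure); `--source arxiv` /
`--source zbmath` on RP-forces-rotation and multivariate complete monotonicity (0, 0); OpenAlex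
unavailable (HTTP 429), one searchd
timeout (rc 75). Theses of the sub re-read: HyperoctahedralRP, PositivityBegetsConformality,
PrecisionLaplacian, IsingEuclidUpgrade (+ both
refutation files).
Ne  [refs: 10.1016/0375-9601(76, 10.1214/aop/1176996606, 1912.07973, cond-mat/9705086, 2105.09781, doi:10.1016/0375-9601, doi:10.1214/aop/1176996606, FrohlichEtAl1978]

Barriers (technique_class: gaussian-scale-mixture, schur-majorisation, multi-mirror-rp): - technique_class: gaussian-scale-mixture, schur-majorisation, multi-mirror-rp
- Literature.Barriers.CriticalPhenomena.ScaleCovarianceNotMoebius: its class EuclideanScaleUpgrade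
uses only Euclidean invariance + scale covariance of a limit; here the inputs are a LATTICE cone
condition (GSM) plus nine lattice reflection positivities and the output of the new cruxes is
isotropy of S₂, not inversion; the inversion step (D) keeps HasPointwiseScalingLimit (criticalCorr
3) and the NonCoincident normalisation, the model-specific form the barrier and
Theorems/IsingEuclidUpgradeRefutations.lean leave open; the barrier's witness is already
O(3)-invariant and GSM-compatible, consistent.
- Literature.Barriers.CriticalPhenomena.BootstrapLatticeBlindness: evaded — GSM is
interaction-specific and predicts its own failure off the n.n. model (third-neighbour coupling q₃ >
q₃^iso = 0.129 flips the ℓ = 4 amplitude, hence reverses the Schur order at large r), and diagonal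
site-plane RP dies with a bond across x₁ = x₂; nothing here is lattice-blind.
- Literature.Barriers.CriticalPhenomena.LiouvilleRigidity: respected — no conformal maps, discrete
holomorphicity, SLE or Virasoro; isotropy from a cone condition + mirrors + one-variable analyticity
in mirror time.
- Literature.Barriers.CriticalPhenomena.LongRangeTrivialityOnZ3: not engaged by (G),(R),(N)
(two-point/isotropy structure; GSM is dimension-uniform and true in Gaussian cases, harmless for
isotropy); its RP long-range witnesses J = g(‖x‖₁)

Novelty grade: new-mechanism — route-review gen-2 (refuter 81300ae8-g2) NOVELTY new-mechanism, carried by r2 CriticalTwoPointGSM (card K1): critical <s0sx> on Z^3 jointly completely monotone in the squared coordinates. Costume check: Schoenberg's class (radial positive-definite in every dimension = Gaussian scale mixtures) impose (refuter refuter-rreview-route-CriticalPhenomena--81300ae8-g2-0, 2026-08-15T14:58:34Z; prior: doi:10.1214/aop/1176996606 (Hartman-Watson law; free lattice Green function is GSM), Schoenberg1938 (radial positive-definite on all R^d = Gaussian scale mixtures), BergChristensenRessel1984 s4.6 (multivariate Bernstein-Widder), MessagerMiracleSoleJSP1977 / Hegerfeldt1977 (l1/linf sandwich), arXiv:1912.07973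 Prop 4.2/4.6 (per-direction Stieltjes structure), FrohlichEtAl1978 (site/diagonal-plane RP)

History (route lifecycle, newest last):
- 2026-08-25T15:55:33Z · DORMANT — reconciler: no traction for 7.8 d (last activity item-evidence-added at 2026-08-17T19:18:53Z); parked, not closed — `ledger route dormant route-CriticalPhenomen (operator:999:1984148)

sub-problem: Ising3DConformalLimit · status: dormant · opened planner-plancard-CriticalPhenomena-Ising3DCon-4d63dd8b-0 2026-08-15T12:43:07Z · rev 4 · ledger route-CriticalPhenomena-GaussianScaleMixture
GENERATED by the gate from the ledger (D-0016/17). Provers cite these decls: `theorem foo : Summit.CriticalPhenomena.Ising3DConformalLimit.Theses.GaussianScaleMixture.<Decl> := …` in Summits/CriticalPhenomena/Ising3DConformalLimit/Theorems/<Name>.lean.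
-/

namespace Summit.CriticalPhenomena.Ising3DConformalLimit.Theses.GaussianScaleMixture

open scoped BigOperators Topology Manifold Classical MeasureTheory ProbabilityTheory Matrix InnerProductSpace ComplexConjugate ContinuousMap
open Filter Set Function TopologicalSpace MeasureTheory

attribute [summit_statement] _root_.Ising3DConformalLimit

/-- item stmt-CriticalPhenomena-8365 · crux · rank 2 · open · by planner
why it might fail: Only one-direction structure is proved (bond-RP Stieltjes form per axis — each axial restriction is already a GSM; MMS monotonicity); nothing signs JOINT mixed differences, e.g. G(1,0,0)+G(2,1,0) ≥ G(2,0,0)+G(1,1,0). Exact GSM at |x| ≤ 3 may be NNLS-infeasible even if the asymptotic ℓ=4 sign fits.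
sources: arXiv:1912.07973, MessagerMiracleSoleJSP1977, Hegerfeldt1977, doi:10.1214/aop/1176996606, Hasenbusch2021, CampostriniEtAl1998
[crux] (card K1) GSM at β_c(3): there is an exchangeable probability measure ν on the closed octant
[0,∞)³ with ⟨σ₀σ_x⟩⁺_{β_c,0} = ∫ exp(−Σᵢ sᵢxᵢ²) ν(ds) for every x ∈ ℤ³ (ν(mass)=1 because G(0)=1) —
the critical two-point function is completely monotone in the squared coordinates, a positive
superposition of axis-aligned Gaussian kernels ("Brownian motion with three exchangeable random
clocks"). Consistent with everything proved (MMS sandwich, per-direction Stieltjes structure, IR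
monotonicity of Ĝ in each |p_j|), exact in every solvable member (free fields of all masses, d = 1,
N = ∞, high-T leading order) and with the sign of the 3D anisotropy amplitude. [difficulty:
open-problem] -/
@[route_item "route-CriticalPhenomena-GaussianScaleMixture", crux]
def CriticalTwoPointGSM : Prop :=
  ∃ ν : MeasureTheory.Measure (Fin 3 → ℝ), MeasureTheory.IsProbabilityMeasure ν ∧ ν {s | ∃ i, s i < 0} = 0 ∧ (∀ σ : Equiv.Perm (Fin 3), ν.map (fun s : Fin 3 → ℝ => s ∘ σ) = ν) ∧ ∀ x : Literature.Probability.LatticeModels.Site 3, Literature.Probability.LatticeModels.criticalTwoPoint 3 x = ∫ s, Real.exp (-∑ i, s i * ((x i : ℝ)) ^ 2) ∂ν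

/-- item stmt-CriticalPhenomena-8366 · crux · rank 3 · closed · proved by Summit.CriticalPhenomena.Ising3DConformalLimit.Theorems.gsmRigidity_proof (prover) · by planner
why it might fail: Each simplex component (ω·x²)^(−Δ) is coordinate-mirror RP and the isotropic one has strictly positive mirror-time spectral weight (E²−q²)^(Δ−3/2) (FrankLieb2010 §2.1); swap-rigidity rests on growth e^(κ(ω)|q|τ) at imaginary time, κ(ω)→0 at the centre — a Φ with density near the centre may stay CM.
sources: FrankLieb2010, FrohlichEtAl1978, GlimmJaffe1987, BergChristensenRessel1984, SchillingSongVondracek2012, DuminilcopinPanis2025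
[crux] (card K2 = DQR, kernel form) every continuous positive kernel K on ℝ³∖0, homogeneous of
degree −2Δ with 1/2 ≤ Δ ≤ 1, invariant and reflection positive w.r.t. the nine lattice mirror
normals eᵢ, eᵢ ± eⱼ (the hypotheses of HRP2Rigidity, stmt-1979, verbatim) which is moreover a
Gaussian scale mixture off the origin (K(x) = ∫ e^{−Σ sᵢxᵢ²} ν(ds), ν a Radon measure on the closed
octant, integrand integrable at every x ≠ 0) is invariant under every linear isometry. Equivalent
simplex form: an exchangeable Φ on the 2-simplex with Γ(Δ)∫(ω·x²)^{−Δ}Φ(dω) swap-reflection-positive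
is δ_centre (coordinate mirrors are RP termwise since (ω·x²)^{−Δ} is the Riesz kernel after a
diagonal linear change and Δ ≥ 1/2; anti-diagonal ⇔ swap for coordinatewise-even kernels). Strictly
weaker than HRP2Rigidity; its negation refutes stmt-1979 too. [difficulty: L] -/
@[route_item "route-CriticalPhenomena-GaussianScaleMixture", crux]
def GSMRigidity : Prop :=
  ∀ (Δ : ℝ) (K : EuclideanSpace ℝ (Fin 3) → ℝ), 1/2 ≤ Δ → Δ ≤ 1 → ContinuousOn K {0}ᶜ → (∀ x, x ≠ 0 → 0 < K x) → (∀ c : ℝ, 0 < c → ∀ x, K (c • x) = c ^ (-(2 * Δ)) * K x) → (∀ n : EuclideanSpace ℝ (Fin 3), (∃ i j : Fin 3, i ≠ j ∧ (n = EuclideanSpace.single i 1 ∨ n = EuclideanSpace.single i 1 + EuclideanSpace.single j 1 ∨ n = EuclideanSpace.single i 1 - EuclideanSpace.single j 1)) → (∀ x, K (((ℝ ∙ n)ᗮ).reflection x) = K x) ∧ (∀ (m : ℕ) (p : Fin m → EuclideanSpace ℝ (Fin 3)) (c : Fin m → ℝ), (∀ a, 0 < inner ℝ (p a) n) → 0 ≤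 ∑ a, ∑ b, c a * c b * K (p a - ((ℝ ∙ n)ᗮ).reflection (p b)))) → (∃ ν : MeasureTheory.Measure (Fin 3 → ℝ), ν {s | ∃ i, s i < 0} = 0 ∧ ∀ x, x ≠ 0 → MeasureTheory.Integrable (fun s => Real.exp (-∑ i, s i * (x i) ^ 2)) ν ∧ K x = ∫ s, Real.exp (-∑ i, s i * (x i) ^ 2) ∂ν) → ∀ (R : EuclideanSpace ℝ (Fin 3) ≃ₗᵢ[ℝ] EuclideanSpace ℝ (Fin 3)) (x : EuclideanSpace ℝ (Fin 3)), K (R x) = K x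

/-- item stmt-CriticalPhenomena-8367 · crux · rank 4 · closed · proved by Summit.CriticalPhenomena.Ising3DConformalLimit.Cruxes.RotationUpgradeFromTwoPoint.NullLaplacianEdgeGaussianity.RotationUpgradeFromTwoPoint_of @ 97caabcac6d4 (prover) · by planner
why it might fail: No theorem upgrades two-point isotropy to n-point O(3) invariance: nine-direction OS positivity + B₃ + one Δ do not visibly constrain S₄ (a B₃- but not O(3)-invariant S₄ with round S₂ violates no known inequality); the planar proof arXiv:2012.11672 is 2D-specific (star–triangle).
sources: DuminilCopinICM2022, arXiv:2012.11672, GlimmJaffe1987, FrohlichEtAl1978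
[crux] every normalised (S = 0 off NonCoincident), non-degenerate, translation-invariant,
scale-covariant pointwise scaling limit S of criticalCorr 3 (ρ > 0 on (0,1]) whose two-point kernel
x ↦ S 2 (0,x) is invariant under all linear isometries (x ≠ 0) is IsRotationInvariant (all n, O(3)
incl. reflections). The n-point half of the isotropy problem, stated so that HyperoctahedralRP can
consume it too (HRP2Rigidity ∘ TwoPointKernelOfLimit gives the hypothesis); intended engines: OS
continuation of S_n in the nine lattice time directions + B₃ + round S₂, or boost/modular
covariance. [difficulty: open-problem] -/
@[route_item "route-CriticalPhenomena-GaussianScaleMixture", crux]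
def RotationUpgradeFromTwoPoint : Prop :=
  ∀ (ρ : ℝ → ℝ) (Δ : ℝ) (S : Literature.Probability.LatticeModels.CorrFamily 3), (∀ δ ∈ Set.Ioc (0:ℝ) 1, 0 < ρ δ) → Literature.Probability.LatticeModels.HasPointwiseScalingLimit (Literature.Probability.LatticeModels.criticalCorr 3) ρ S → (∀ n z, z ∉ Literature.Probability.LatticeModels.NonCoincident 3 n → S n z = 0) → Literature.Probability.LatticeModels.IsNondegenerateTwoPoint S → Literature.Probability.LatticeModels.IsTranslationInvariant S → Literature.Probability.LatticeModels.IsScaleCovariant Δ S → (∀ (R : EuclideanSpace ℝ (Fin 3) ≃ₗᵢ[ℝ] EuclideanSpace ℝ (Fin 3)) (x : EuclideanSpace ℝ (Fin 3)), x ≠ 0 → S 2 ![0, R x] = S 2 ![0, x]) → Literature.Probability.LatticeModels.IsRotationInvariant S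

/-- item stmt-CriticalPhenomena-1981 · crux · rank 5 · SPLIT (gen 2) into TwoPointDoubling, ClusterSetTotallyDisconnected + glue Summit.CriticalPhenomena.Ising3DConformalLimit.Cruxes.ExistsScaleCovariantLimit.SplitGlue.hrp_crux_of_doubling_of_totallyDisconnected · direct attempts still welcome (low priority) · by planner
why it might fail: Full δ→0⁺ convergence with ONE continuous Δ is open on ℤ³ (DuminilCopinICM2022 §8.4): c|x|⁻² ≤ G ≤ C|x|⁻¹ gives only subsequential limits, Δ ∈ [1/2,1]; log-periodic (discretely scale-covariant) profiles, realised in hierarchical models (DerridaItzyksonLuck1984), are not excluded by RP/GKS.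
sources: DuminilCopinICM2022, DuminilcopinPanis2025, arXiv:1912.07973, AizenmanDuminilCopinAnnals2021, DerridaItzyksonLuck1984
earlier split gen 1: TwoPointDoubling, ClusterSetTotallyDisconnected — retired -
[crux r4, (C), existence WITHOUT rotations] There are ρ > 0 on (0,1], Δ > 0 and S with
HasPointwiseScalingLimit (criticalCorr 3) ρ S, S = 0 off NonCoincident, IsNondegenerateTwoPoint S,
IsTranslationInvariant S, IsScaleCovariant Δ S. Strictly weaker than CritIsing3DEuclideanLimit (item
0638: rotations included) — on this route isotropy is OUTPUT. Inputs in tree: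
criticalTwoPoint_bounds_holds (c|x|⁻² ≤ G ≤ C|x|⁻¹ ⇒ subsequential limits, Δ ∈ [1/2,1]); missing:
uniqueness/full-filter convergence and continuous scale covariance (DuminilCopinICM2022 §8.4 p.29:
'widely open'). -/
@[route_item "route-CriticalPhenomena-GaussianScaleMixture", crux]
def ExistsScaleCovariantLimit : Prop :=
  ∃ (ρ : ℝ → ℝ) (Δ : ℝ) (S : Literature.Probability.LatticeModels.CorrFamily 3), (∀ δ ∈ Set.Ioc (0:ℝ) 1, 0 < ρ δ) ∧ 0 < Δ ∧ Literature.Probability.LatticeModels.HasPointwiseScalingLimit (Literature.Probability.LatticeModels.criticalCorr 3) ρ S ∧ (∀ n z, z ∉ Literature.Probability.LatticeModels.NonCoincident 3 n → S n z = 0) ∧ Literature.Probability.LatticeModels.IsNondegenerateTwoPoint S ∧ Literature.Probability.LatticeModels.IsTranslationInvariant S ∧ Literature.Probability.LatticeModels.IsScaleCovariant Δ S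

-- parent: ExistsScaleCovariantLimit · child (gen 2)
/--     item stmt-CriticalPhenomena-6150 · crux · rank 501 · open
    parent: ExistsScaleCovariantLimit · by planner
    why it might fail: Open in print (ADC21 Rem 5.10; DCP24 Thm 1.5). Every two-point axiomatic in tree (all-mirror RP, MMS, IR, sliding IR, DCP24 1.2/1.3, complete monotonicity) is passed by fat GSM/Yukawa mixtures k⁻¹Σwᵢe^{−k/Mᵢ} losing doubling by √(wᵢ₊₁/wᵢ)→0: needs an Ising-specific exponent-free two-scale bound.
    sources: AizenmanDuminilCopinAnnals2021, arXiv:1912.07973, DuminilcopinPanis2025, arXiv:2404.05700, arXiv:2509.02850, DuminilCopinICM2022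
[crux] (D) ALL-SCALE DOUBLING of the axial critical two-point function on ℤ³: there is κ > 0 with
g(2n) ≥ κ·g(n) for all n ≥ 1, g(n) := ⟨σ₀σ_{n e₁}⟩⁺_{β_c(3)} (card item M3; = D1 of card
every-scale-regular-multiplicative-fekete). With MMS it gives G(z′) ≍ G(z) for ‖z′‖ ≍ ‖z‖ in all
directions; it is the one open LATTICE input of the compactness half and is filed first (the import
cone of everything below is otherwise proved: criticalTwoPoint_bounds_holds,
messager_miracleSole_holds, RP lemmas). [difficulty: open-problem] -/
@[route_item "route-CriticalPhenomena-GaussianScaleMixture", crux]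
def TwoPointDoubling : Prop :=
  ∃ κ : ℝ, 0 < κ ∧ ∀ n : ℕ, 1 ≤ n → κ * Literature.Probability.LatticeModels.criticalTwoPoint 3 (Pi.single 0 (n : ℤ)) ≤ Literature.Probability.LatticeModels.criticalTwoPoint 3 (Pi.single 0 (2 * (n : ℤ)))

-- parent: ExistsScaleCovariantLimit · child (gen 2)
/--     item stmt-CriticalPhenomena-4659 · crux · rank 502 · open
    parent: ExistsScaleCovariantLimit · by planner
    why it might fail: Fails if Δ drifts along scales (arc of pure-power cluster points), if the zoom has a limit cycle (DSI witnesses W_ε pass all two-point axiomatics with two cluster points, Disproof §E), or if cluster points evade locality; isolation of Ising₃ among local 3D CFTs is expected, not proved.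
    sources: Rychkov2020, arXiv:2007.14315, PolandRychkovVichi2019, arXiv:1805.04405, DuminilCopinICM2022, Literature.Probability.LatticeModels.PointwiseScalingLimitDiscreteScaleInvariance
[crux] the cluster set 𝒞 of the self-normalised family is totally disconnected in the pointwise
(product) topology of CorrFamily 3 (on 𝒞, compact under Reg, this coincides with the locally uniform
topology; pointwise is the stronger ask otherwise). INTENDED ENGINE (card items (2)–(4), the route's
point, layer 2): 𝒞 ⊆ 𝓘 := σ-correlator families of LOCAL unitary ℤ₂-symmetric 3D CFTs with exactly
one relevant odd and exactly one relevant non-identity even scalar and Δ_σ ≤ 1 (lattice side: OS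
positivity, clustering, covariance and spectrum of cluster points), and 𝓘 is totally disconnected
(CFT side, lattice-blind: 'It is expected that most local CFTs are isolated. One exception are CFTs
with exactly marginal fields of dimension Δ = d … A folk conjecture says that exactly marginal
fields in d ≥ 3 require supersymmetry' — Rychkov2020, arXiv:2007.14315 p.8, read this session; LOCAL
= 'critical points of lattice models with finite-range interactions', ibid., which is what excludes
the non-local long-range arc; an ANALYTIC isolation theorem for exact solutions of crossing — NOT a
finite-Λ positivity certificate, which only gives diam ≤ ε(Λ): refuter flag on the card, accepted).
Both halves -/
@[route_item "route-CriticalPhenomena-GaussianScaleMixture", crux]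
def ClusterSetTotallyDisconnected : Prop :=
  IsTotallyDisconnected {S : Literature.Probability.LatticeModels.CorrFamily 3 | (∀ n x, x ∉ Literature.Probability.LatticeModels.NonCoincident 3 n → S n x = 0) ∧ ∃ u : ℕ → ℝ, (∀ k, u k ∈ Set.Ioc (0:ℝ) 1) ∧ Filter.Tendsto u Filter.atTop (nhds 0) ∧ ∀ n, TendstoLocallyUniformlyOn (fun k => Literature.Probability.LatticeModels.rescaledCorrelator (Literature.Probability.LatticeModels.criticalCorr 3) (fun δ : ℝ => (Literature.Probability.LatticeModels.criticalTwoPoint 3 (Pi.single 0 ⌊δ⁻¹⌋)) ^ (-(1/2:ℝ))) n (u k)) (S n) Filter.atTop (Literature.Probability.LatticeModels.NonCoincident 3 n)}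

/-- glue for the split of `ExistsScaleCovariantLimit`: landed theorem `Summit.CriticalPhenomena.Ising3DConformalLimit.Cruxes.ExistsScaleCovariantLimit.SplitGlue.hrp_crux_of_doubling_of_totallyDisconnected`. -/
theorem ExistsScaleCovariantLimitGlueBy_holds : TwoPointDoubling → ClusterSetTotallyDisconnected → ExistsScaleCovariantLimit := _root_.Summit.CriticalPhenomena.Ising3DConformalLimit.Cruxes.ExistsScaleCovariantLimit.SplitGlue.hrp_crux_of_doubling_of_totallyDisconnected

/-- item stmt-CriticalPhenomena-1982 · crux · rank 6 · open · by planner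
why it might fail: Scale + Euclid + RP ⇏ Möbius in general (free Maxwell d=3, ElshowkNakayamaRychkov2011; barrier ScaleCovarianceNotMoebius), so Ising-specific input is needed; absence of a dimension-2 virial current is known only non-rigorously (D_V ≥ 2+η, DTW 2016) and numerically (Δ_V > 5.0, MenesesEtAl2019).
sources: ElshowkNakayamaRychkov2011, Nakayama2015, DelamotteTissierWschebor2016, MenesesEtAl2019, PolandRychkovVichi2019, DuminilCopinICM2022
[crux r5, (D), inversion upgrade re-typed] Every pointwise scaling limit S of criticalCorr 3 (ρ > 0
on (0,1]) that is normalised (S = 0 off NonCoincident), non-degenerate, Euclidean invariant and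
scale covariant with Δ is IsInversionCovariant Δ (hence Möbius). This is (U) of route
IsingEuclidUpgrade (item 0637, refuted AS TYPED by not_inversionUpgrade_of_euclideanLimit through
values on the coincident locus) with the normalisation hypothesis the refutation file prescribes;
the model-blind version is false (Literature.Barriers.CriticalPhenomena.ScaleCovarianceNotMoebius;
free Maxwell d=3, ElshowkNakayamaRychkov2011), so any proof must use the Ising hypothesis (RP +
locality / absence of a dimension-2 virial current: DelamotteTissierWschebor2016 §5–6,
Nakayama2015). -/
@[route_item "route-CriticalPhenomena-GaussianScaleMixture", crux]
def InversionUpgradeNormalised : Prop :=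
  ∀ (ρ : ℝ → ℝ) (Δ : ℝ) (S : Literature.Probability.LatticeModels.CorrFamily 3), (∀ δ ∈ Set.Ioc (0:ℝ) 1, 0 < ρ δ) → Literature.Probability.LatticeModels.HasPointwiseScalingLimit (Literature.Probability.LatticeModels.criticalCorr 3) ρ S → (∀ n z, z ∉ Literature.Probability.LatticeModels.NonCoincident 3 n → S n z = 0) → Literature.Probability.LatticeModels.IsNondegenerateTwoPoint S → Literature.Probability.LatticeModels.IsEuclideanInvariant S → Literature.Probability.LatticeModels.IsScaleCovariant Δ S → Literature.Probability.LatticeModels.IsInversionCovariant Δ S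

/-- item stmt-CriticalPhenomena-0636 · crux · rank 7 · open · by planner
why it might fail: No proof that U₄ ≢ 0 in d = 3: the double-current intersection probability at macroscopic separation must stay > 0 as δ→0, but intersection/bubble methods only prove triviality (d ≥ 4, Aizenman1982, ADC 2021; RP long-range α < 3/2 on ℤ³); non-triviality rests on ε-expansion, bootstrap and MC only.
sources: AizenmanDuminilCopinAnnals2021, Aizenman1982, DuminilCopinICM2022
Crux r4 (non-triviality in d=3): every non-degenerate pointwise scaling limit S of the renormalised
critical Ising correlators on Z^3 has connected four-point function U4 ≢ 0 on non-coincident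
configurations. Intended tool: the random-current identity U4(x,y,z,t) =
−2⟨σxσy⟩⟨σzσt⟩·P^{xy,zt}[C_{n1+n2}(x) ∩ C_{n1+n2}(z) ≠ ∅] (Aizenman 1982; ADC2021 arXiv:1912.07973
eq. (3.11)): non-Gaussianity ⇔ the intersection probability of the two double-current clusters at
macroscopic separation does not vanish as δ → 0. Contrast: for d ≥ 4 every such limit IS Gaussian
(Literature.Probability.LatticeModels.highDim_triviality). Its negation refutes the conjunct
Ising3DConformalLimit itself. -/
@[route_item "route-CriticalPhenomena-GaussianScaleMixture", crux]
def IsingEuclidUpgradeR4NonGaussian : Prop :=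
  ∀ (ρ : ℝ → ℝ) (S : Literature.Probability.LatticeModels.CorrFamily 3), (∀ δ ∈ Set.Ioc (0:ℝ) 1, 0 < ρ δ) → Literature.Probability.LatticeModels.HasPointwiseScalingLimit (Literature.Probability.LatticeModels.criticalCorr 3) ρ S → Literature.Probability.LatticeModels.IsNondegenerateTwoPoint S → Literature.Probability.LatticeModels.HasNontrivialU4 S

/-- item stmt-CriticalPhenomena-17729 · support · rank 9 · open · by planner
[support — filed by the crux-strategist of stmt-CriticalPhenomena-8365 as the RE-TYPED FALSIFIABLE
CORE of crux r2 CriticalTwoPointGSM; an OPEN PROBLEM, do not attempt without a new positivity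
mechanism] Closed-cone (cube) form of the Gaussian-scale-mixture conjecture: there is a probability
measure μ on ℝ³ carried by the closed cube [0,1]³ (cube coordinates tᵢ = e^{−sᵢ}; faces tᵢ = 0 =
clocks of infinite speed allowed; ℕ-powers, 0⁰ = 1) with ⟨σ₀σ_x⟩⁺_{β_c}(ℤ³) = ∫ ∏ᵢ tᵢ^{xᵢ²} dμ(t)
for every x ∈ ℤ³. Facts already LANDED about it (all --supports stmt-CriticalPhenomena-8365): (1)
CriticalTwoPointGSM ⇒ ClosedConeGSM (Theorems.closedConeGSM_of_criticalTwoPointGSM, p123948) and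
CriticalTwoPointGSM ⇔ ClosedConeGSM ∧ FaceAbsorption
(Theorems.criticalTwoPointGSM_iff_closedCone_faceAbsorption), FaceAbsorption being a data-invisible
residue; (2) ClosedConeGSM ⇔ every square-lacunary dual-cone certificate passes: Σ c_k G(x_k) ≥ 0
whenever Σ c_k ∏ tᵢ^{x_{k,i}²} ≥ 0 on [0,1]³ (Theorems.closedConeGSM_iff_dualCone /
cubeRep_iff_dualCone, p123948/p123076) — exactly what the disprover's numerics test (inside the cone
to χ² ≈ 2·10⁻⁴ on |x| ≤ 6, L ≤ 128 + FSS; exact 2D sibling feasible to 1e−15; exa -/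
@[route_item "route-CriticalPhenomena-GaussianScaleMixture"]
def ClosedConeGSM : Prop :=
  ∃ μ : MeasureTheory.Measure (Fin 3 → ℝ), MeasureTheory.IsProbabilityMeasure μ ∧ μ {t | ∃ i, t i < 0 ∨ 1 < t i} = 0 ∧ ∀ x : Literature.Probability.LatticeModels.Site 3, Literature.Probability.LatticeModels.criticalTwoPoint 3 x = MeasureTheory.integral μ (fun t : Fin 3 → ℝ => Finset.univ.prod (fun i : Fin 3 => (t i) ^ ((x i).natAbs ^ 2)))

/-- item stmt-CriticalPhenomena-1983 · support · rank 9 · closed · proved by Summit.CriticalPhenomena.Ising3DConformalLimit.HyperoctahedralRPTwoPoint.twoPointKernelOfLimit_proof (prover) · by planner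
sources: MessagerMiracleSoleJSP1977, FrohlichEtAl1978, DuminilcopinPanis2025
[support, glue for (A) at n = 2] For every pointwise scaling limit S of criticalCorr 3 (ρ > 0 on
(0,1]) that is non-degenerate, translation invariant and scale covariant with Δ, the kernel K x := S
2 ![0, x] satisfies the hypotheses of HRP2Rigidity: 1/2 ≤ Δ ≤ 1 (scalingDimension_mem_Icc_holds),
ContinuousOn K {0}ᶜ (Messager–Miracle-Solé axis + diagonal monotonicity, messager_miracleSole_holds
/ _diag_holds, pass to the limit; with homogeneity and evenness they sandwich K near every x ≠ 0), K
> 0 off 0, K(c•x) = c^(−2Δ) K x, invariance under the nine lattice mirrors (lattice symmetry +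
continuity) and nine-mirror reflection positivity of the finite sums (CriticalCorrNineMirrorRP +
translation invariance + symmetry of S 2). -/
@[route_item "route-CriticalPhenomena-GaussianScaleMixture", crux]
def TwoPointKernelOfLimit : Prop :=
  ∀ (ρ : ℝ → ℝ) (Δ : ℝ) (S : Literature.Probability.LatticeModels.CorrFamily 3), (∀ δ ∈ Set.Ioc (0:ℝ) 1, 0 < ρ δ) → Literature.Probability.LatticeModels.HasPointwiseScalingLimit (Literature.Probability.LatticeModels.criticalCorr 3) ρ S → Literature.Probability.LatticeModels.IsNondegenerateTwoPoint S → Literature.Probability.LatticeModels.IsTranslationInvariant S → Literature.Probability.LatticeModels.IsScaleCovariant Δ S → (1/2 ≤ Δ ∧ Δ ≤ 1) ∧ ContinuousOn (fun x : EuclideanSpace ℝ (Fin 3) => S 2 ![0, x]) {0}ᶜ ∧ (∀ x : EuclideanSpace ℝ (Fin 3), x ≠ 0 → 0 < S 2 ![0, x]) ∧ (∀ c : ℝ, 0 < c → ∀ x : EuclideanSpace ℝ (Fin 3), S 2 ![0, c • x] = c ^ (-(2 * Δ)) * S 2 ![0, x]) ∧ (∀ n : EuclideanSpace ℝ (Fin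 3), (∃ i j : Fin 3, i ≠ j ∧ (n = EuclideanSpace.single i 1 ∨ n = EuclideanSpace.single i 1 + EuclideanSpace.single j 1 ∨ n = EuclideanSpace.single i 1 - EuclideanSpace.single j 1)) → (∀ x : EuclideanSpace ℝ (Fin 3), S 2 ![0, ((ℝ ∙ n)ᗮ).reflection x] = S 2 ![0, x]) ∧ (∀ (m : ℕ) (p : Fin m → EuclideanSpace ℝ (Fin 3)) (c : Fin m → ℝ), (∀ a, 0 < inner ℝ (p a) n) → 0 ≤ ∑ a, ∑ b, c a * c b * S 2 ![0, p a - ((ℝ ∙ n)ᗮ).reflection (p b)]))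

/-- `TwoPointKernelOfLimit` holds: proved by `Summit.CriticalPhenomena.Ising3DConformalLimit.HyperoctahedralRPTwoPoint.twoPointKernelOfLimit_proof`. -/
theorem TwoPointKernelOfLimit_holds : TwoPointKernelOfLimit := _root_.Summit.CriticalPhenomena.Ising3DConformalLimit.HyperoctahedralRPTwoPoint.twoPointKernelOfLimit_proof

/-- item stmt-CriticalPhenomena-8368 · support · rank 9 · closed · proved by Summit.CriticalPhenomena.Ising3DConformalLimit.Theorems.limitKernelGSM_proof (prover) · by planner
sources: BergChristensenRessel1984, SchillingSongVondracek2012, arXiv:1912.07973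
[support] glue: CriticalTwoPointGSM ⇒ for every non-degenerate, translation-invariant,
scale-covariant pointwise scaling limit S of criticalCorr 3 the kernel K(x) = S 2 (0,x) is a
Gaussian scale mixture off the origin (Radon ν on the closed octant, integrand integrable and K(x) =
∫e^(−Σ sᵢxᵢ²)ν(ds) at every x ≠ 0). Route: ν_δ := ρ(δ)²·(s ↦ s/δ²)_*ν; F_δ(u) = ∫e^(−t·u)ν_δ(dt) is
CM and ρ(δ)²G(⌊x/δ⌋) = F_δ((δ⌊xᵢ/δ⌋)²ᵢ); squeeze between K((1±ε)x) by coordinatewise monotonicity +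
homogeneity ⇒ F_δ → F on the open octant; limits of CM functions are CM ⇒ Bernstein–Widder on the
cone gives ν_∞; boundary faces by monotone convergence + continuity of K at the axes/planes (ℓ¹/ℓ∞
and diagonal MMS sandwich). Measure-free fallback interface (finite-difference CM) if provers
prefer. [difficulty: M] -/
@[route_item "route-CriticalPhenomena-GaussianScaleMixture", crux]
def LimitKernelGSM : Prop :=
  CriticalTwoPointGSM → ∀ (ρ : ℝ → ℝ) (Δ : ℝ) (S : Literature.Probability.LatticeModels.CorrFamily 3), (∀ δ ∈ Set.Ioc (0:ℝ) 1, 0 < ρ δ) → Literature.Probability.LatticeModels.HasPointwiseScalingLimit (Literature.Probability.LatticeModels.criticalCorr 3) ρ S → Literature.Probability.LatticeModels.IsNondegenerateTwoPoint S → Literature.Probability.LatticeModels.IsTranslationInvariant S → Literature.Probability.LatticeModels.IsScaleCovariant Δ S → ∃ ν : MeasureTheory.Measure (Fin 3 → ℝ), ν {s | ∃ i, s i < 0} = 0 ∧ ∀ x : EuclideanSpace ℝ (Fin 3), x ≠ 0 → MeasureTheory.Integrable (fun s => Real.exp (-∑ i, s i * (x i) ^ 2)) ν ∧ S 2 ![0,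 x] = ∫ s, Real.exp (-∑ i, s i * (x i) ^ 2) ∂ν

/-- item stmt-CriticalPhenomena-8369 · support · rank 9 · closed · proved by Summit.CriticalPhenomena.Ising3DConformalLimit.Theorems.oneAmplitudeIsotropy_proof @ b03e6b617908 (prover) · by planner
sources: doi:10.1214/aop/1176996606, BergChristensenRessel1984, arXiv:1912.07973
[support] dividend "O(3) from one amplitude" (pure analysis, provable now): if K(x) = ∫e^(−Σ
sᵢxᵢ²)ν(ds) off the origin with ν exchangeable on the closed octant, then K(e₁) = K((e₁+e₂)/√2)
forces K(Rx) = K(x) for every linear isometry R and x ≠ 0. Proof: K(e₁) = ∫(e^(−s₁)+e^(−s₂))/2 dν ≥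
∫e^(−(s₁+s₂)/2)dν = K((e₁+e₂)/√2) by convexity, with equality iff s₁ = s₂ ν-a.e.; exchangeability
then gives s₁ = s₂ = s₃ a.e. and K is a function of ‖x‖. No homogeneity needed; for the
scale-covariant limit kernel the two numbers are the axis and face-diagonal amplitudes A(e₁) ≥
A((e₁+e₂)/√2) — isotropy of S₂ ⇔ one amplitude identity between the two reflection-positive transfer
directions. [difficulty: provable-now] -/
@[route_item "route-CriticalPhenomena-GaussianScaleMixture", crux]
def OneAmplitudeIsotropy : Prop :=
  ∀ (K : EuclideanSpace ℝ (Fin 3) → ℝ) (ν : MeasureTheory.Measure (Fin 3 → ℝ)), ν {s | ∃ i, s i < 0} = 0 → (∀ σ : Equiv.Perm (Fin 3), ν.map (fun s : Fin 3 → ℝ => s ∘ σ) = ν) → (∀ x, x ≠ 0 → MeasureTheory.Integrable (fun s => Real.exp (-∑ i, s i * (x i) ^ 2)) ν ∧ K x = ∫ s, Real.exp (-∑ i, s i * (x i) ^ 2) ∂ν) → K (EuclideanSpace.single 0 1) = K (EuclideanSpace.single 0 (Real.sqrt 2 / 2) + EuclideanSpace.single 1 (Real.sqrt 2 / 2)) →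 ∀ (R : EuclideanSpace ℝ (Fin 3) ≃ₗᵢ[ℝ] EuclideanSpace ℝ (Fin 3)) (x : EuclideanSpace ℝ (Fin 3)), x ≠ 0 → K (R x) = K x

/-- item stmt-CriticalPhenomena-8370 · support · rank 9 · closed · proved by Summit.CriticalPhenomena.Ising3DConformalLimit.Theorems.gsmSchurOrder_proof (prover) · by planner
sources: MessagerMiracleSoleJSP1977, Hegerfeldt1977, arXiv:2105.09781
[support] dividend (provable now): Schur order of the critical two-point function on Euclidean
lattice spheres: CriticalTwoPointGSM ⇒ for x, y ∈ ℤ³ with Σxᵢ² = Σyᵢ², max yᵢ² ≤ max xᵢ² and min xᵢ²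
≤ min yᵢ² (for three coordinates this IS x² ≻ y²), ⟨σ₀σ_y⟩ ≤ ⟨σ₀σ_x⟩; smallest instances G(2,2,1) ≤
G(3,0,0), G(3,2,2) ≤ G(4,1,0), G(4,3,0) ≤ G(5,0,0), G(4,3,1) ≤ G(5,1,0), G(3,3,3) ≤ G(5,1,1),
G(4,3,2) ≤ G(5,2,0), G(4,3,3) ≤ G(5,3,0), G(5,4,3) ≤ G(5,5,0) ≤ G(7,1,0) (NB the card's pair
G(3,3,0) ≤ G(4,1,1) is NOT implied: (16,1,1), (9,9,0) are incomparable). Proof: F(u) = ∫e^(−s·u)dν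
is convex along each transfer u ↦ (u₁+ε, u₂−ε, u₃) and symmetric about ε = (u₂−u₁)/2
(exchangeability), and a 3-vector majorisation is two transfers (Hardy–Littlewood–Pólya); the
Euclidean sphere inserted into the 1977 ℓ∞/ℓ¹ sandwich. [difficulty: provable-now] -/
@[route_item "route-CriticalPhenomena-GaussianScaleMixture", crux]
def GSMSchurOrder : Prop :=
  CriticalTwoPointGSM → ∀ x y : Literature.Probability.LatticeModels.Site 3, (∑ i, (x i) ^ 2 = ∑ i, (y i) ^ 2) → (∀ i, ∃ j, (y i) ^ 2 ≤ (x j) ^ 2) → (∀ i, ∃ j, (x j) ^ 2 ≤ (y i) ^ 2) → Literature.Probability.LatticeModels.criticalTwoPoint 3 y ≤ Literature.Probability.LatticeModels.criticalTwoPoint 3 x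

/-- item stmt-CriticalPhenomena-8371 · assembly · rank 1 · closed · proved by Summit.CriticalPhenomena.Ising3DConformalLimit.Theorems.gaussianScaleMixture_assembly_proof @ 3ffeb756c9fb (prover) · by planner
sources: DuminilCopinICM2022, arXiv:1912.07973
[assembly] CriticalTwoPointGSM → GSMRigidity → LimitKernelGSM → TwoPointKernelOfLimit →
RotationUpgradeFromTwoPoint → ExistsScaleCovariantLimit → InversionUpgradeNormalised →
IsingEuclidUpgradeR4NonGaussian → Ising3DConformalLimit. -/
@[route_item "route-CriticalPhenomena-GaussianScaleMixture", crux]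
def Assembly : Prop :=
  CriticalTwoPointGSM → GSMRigidity → LimitKernelGSM → TwoPointKernelOfLimit → RotationUpgradeFromTwoPoint → ExistsScaleCovariantLimit → InversionUpgradeNormalised → IsingEuclidUpgradeR4NonGaussian → Ising3DConformalLimit

/-! D-0027 §2.1 — DECIDING THEOREM (planner-authored via `route open/edit --closes-file`; by operator:999:2941348 2026-08-15T15:22:35Z):
its hypotheses are this route's items and its conclusion the sub-problem Statement (glue_lint), and it elaborates with this file. -/

@[closes "route-CriticalPhenomena-GaussianScaleMixture"] theorem closes : CriticalTwoPointGSM → GSMRigidity → RotationUpgradeFromTwoPoint → ExistsScaleCovariantLimit → InversionUpgradeNormalised → IsingEuclidUpgradeR4NonGaussian → TwoPointKernelOfLimit → LimitKernelGSM → OneAmplitudeIsotropy → GSMSchurOrder → Assembly → _root_.Ising3DConformalLimit := fun h_CriticalTwoPointGSM h_GSMRigidity h_RotationUpgradeFromTwoPoint h_ExistsScaleCovariantLimit h_InversionUpgradeNormalised h_IsingEuclidUpgradeR4NonGaussian h_TwoPointKernelOfLimit h_LimitKernelGSM h_OneAmplitudeIsotropy h_GSMSchurOrder h_Assembly => h_Assembly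 h_CriticalTwoPointGSM h_GSMRigidity h_LimitKernelGSM h_TwoPointKernelOfLimit h_RotationUpgradeFromTwoPoint h_ExistsScaleCovariantLimit h_InversionUpgradeNormalised h_IsingEuclidUpgradeR4NonGaussian

end Summit.CriticalPhenomena.Ising3DConformalLimit.Theses.GaussianScaleMixture
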